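import Summits.Langlands.Langlands.Theorems.IrreducibilityBySelfDualityReciprocityUpToIrreducibilityWeakExistenceNormTwist
import Literature.NumberTheory.PAdicHodge.FontaineDpstUnconditional
import HarnessLib

/-!
# Line `Sketch` for the crux `ReciprocityUpToIrreducibility` (item stmt-Langlands-14328), wave N15-H:
# `(open kernel) ⊗ ε_ℓ^k` is de Rham above `ℓ` for THE pinned datum, in every rank, with no named fact

Support file (closes nothing; `--supports stmt-Langlands-14328`; registered stub
`stub_isDeRhamFramed_twist_of_isOpen_ker` of the checked skeleton of line `Sketch`, continuation lead
c10, wave N15).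

Let `K` be a number field, `ℓ` a prime, `r : Γ_K → GL_n(ℚ̄_ℓ)` a continuous representation with OPEN
KERNEL, `k ∈ ℤ`, and `ε : Γ_K →ₜ* ℚ̄_ℓˣ` the `k`-th power of the `ℓ`-adic cyclotomic character.  Then
at every place `v ∣ ℓ` the restriction `(r ⊗ ε)|_{Γ_{K_v}}` is de Rham for Fontaine's PINNED datum
`fontainePstAdicCompletion v ℓ hv` — unconditionally (no `FontaineDatumExists`), in every rank `n`.
This is the `ℓ`-adic avatar `r ⊗ ε_ℓ^k` of a norm twist `χ₀ ‖·‖^{-k}` of an Artin-type object, and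
the theorem is the "de Rham above `ℓ`" half of `IsGeometricFramed Rec (r ⊗ ε)` in direction (A).

Proof, all from proved tree theorems:

* `toLocal_twist` (c3, `…WeakExistenceNormTwist`):
  `(r ⊗ ε)|_{Γ_{K_v}} = r|_{Γ_{K_v}} ⊗ (ε ∘ res_v)`;
* an open-kernel `r` has finite image (`Γ_K` compact, so `ker r` has finite index and
  `Γ_K ⧸ ker r ≃ range r`), hence finite image on `Γ_{K_v}` (private copies of c8's
  `finite_range_of_isOpen_ker`, `finite_range_toLocal_of_isOpen_ker` of `…ArtinSectorAboveClause`, not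
  imported here so that this file does not depend on `Theses.IrreducibilityBySelfDuality`), hence
  `r|_{Γ_{K_v}}` is de Rham for the pinned datum, whose period ring IS `B_dR(K_v)` since D1
  (`fontainePstAdicCompletion_isDeRhamFramed_of_finite_range`, Literature `FontaineDpst`);
* `fontainePstAdicCompletion_isDeRhamFramed_tateTwist_of_isDeRhamFramed` (Literature
  `FontaineDpstUnconditional`): Tate twists `ρ ⊗ χ_ℓ^k` of de Rham representations of `Γ_{K_v}` are
  de Rham for the pinned datum, the cyclotomic character of `K_v` being de Rham for it
  unconditionally (`fontainePstAdicCompletion_isDeRhamFramed_cyclotomic`, Fontaine 1994 Exp. III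
  §1.5 and Prop. 1.5.2);
* `cyclotomicCharacter_absGaloisRestrict` (Literature `LocalKroneckerWeberInertiaProofs`):
  `χ_ℓ(res_v σ) = χ_ℓ(σ)` for `σ ∈ Γ_{K_v}`, so `ε ∘ res_v` is the `k`-th power of the cyclotomic
  character of `K_v`.

(The last paragraph of the proof of c9's `weakExistence_rankOne_of_isFiniteOrder_normTwist_all`, in
every rank and with its hypothesis `hcyc` discharged.)

References: J.-M. Fontaine, *Représentations ℓ-adiques potentiellement semi-stables*, Astérisque 223
(1994), Exp. III §1.5, §3, Prop. 1.5.2 [FontaineAsterisque223III]; J.-P. Serre, *Abelian ℓ-adic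
representations and elliptic curves* (1968), Ch. I §1.2, Ch. III §2.3 [SerreAbelianLadic1968].
(buildfix 2026-08-20: comment-only re-land to re-enqueue the module build after its blocking imports were repaired; no declaration changed.)
-/

noncomputable section

set_option linter.dupNamespace false -- project-wide option (lakefile weak.linter.dupNamespace); `Summit.Langlands.Langlands` is the mandated namespace

open scoped NumberField Classical Polynomial MatrixGroups
open Filter IsDedekindDomain Polynomial
open Literature.NumberTheory.Automorphic Literature.NumberTheory.GaloisRepresentations
open Literature.NumberTheory.PAdicHodge
open Summit.Langlands

namespace Summit.Langlands.Langlands.Theorems.ReciprocityUpToIrreducibility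

variable {K : Type} [Field K] [NumberField K] {ℓ : ℕ} [Fact ℓ.Prime]

/-! ### Open kernel ⇒ finite image on every decomposition group -/

/-- A Galois representation with open kernel has finite image: `Γ_K` is compact, so the open subgroup
`ker ρ` has finite index and `Γ_K ⧸ ker ρ ≃ range ρ` (private copy of c8's `finite_range_of_isOpen_ker`
of `…ArtinSectorAboveClause`). [cite: SerreAbelianLadic1968, Ch. III §2.3] -/
private theorem finite_range_of_isOpen_ker_twistDeRham {A : Type*} [CommRing A] [TopologicalSpace A]
    {n : ℕ} (ρ : FramedGaloisRep K A n)
    (hker : IsOpen (ρ.toMonoidHom.ker : Set (Field.absoluteGaloisGroup K))) :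
    (Set.range ρ).Finite := by
  haveI : Finite (Field.absoluteGaloisGroup K ⧸ ρ.toMonoidHom.ker) :=
    Subgroup.quotient_finite_of_isOpen _ hker
  haveI : Finite ρ.toMonoidHom.range :=
    Finite.of_equiv _ (QuotientGroup.quotientKerEquivRange ρ.toMonoidHom).toEquiv
  have h : ((ρ.toMonoidHom.range : Subgroup (GL (Fin n) A)) : Set (GL (Fin n) A)).Finite :=
    Set.toFinite _
  rwa [MonoidHom.coe_range] at h

/-- The restriction to a decomposition group `Γ_{K_v}` of a Galois representation with open kernel
has finite image (`range ρ|_{Γ_{K_v}} ⊆ range ρ`; private copy of c8's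
`finite_range_toLocal_of_isOpen_ker`). [cite: SerreAbelianLadic1968, Ch. III §2.3] -/
private theorem finite_range_toLocal_of_isOpen_ker_twistDeRham {A : Type*} [CommRing A]
    [TopologicalSpace A] {n : ℕ} (ρ : FramedGaloisRep K A n)
    (hker : IsOpen (ρ.toMonoidHom.ker : Set (Field.absoluteGaloisGroup K)))
    (v : HeightOneSpectrum (𝓞 K)) : (Set.range (ρ.toLocal v)).Finite :=
  (finite_range_of_isOpen_ker_twistDeRham ρ hker).subset <| by
    rintro _ ⟨σ, rfl⟩
    exact ⟨absGaloisRestrict K (v.adicCompletion K) σ, (FramedGaloisRep.toLocal_apply v ρ σ).symm⟩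

/-! ### The cyclotomic twist read on a decomposition group -/

/-- **Twisting by a power of the cyclotomic character, read on a decomposition group.**  If
`ε : Γ_K →ₜ* ℚ̄_ℓˣ` is `χ_ℓ^k` (as a `ℚ̄_ℓ`-valued character of `Γ_K`) then `ε ∘ res_v` is `χ_ℓ^k` as
a character of `Γ_{K_v}` (`χ_ℓ(res_v σ) = χ_ℓ(σ)`, `cyclotomicCharacter_absGaloisRestrict`).
[cite: SerreAbelianLadic1968, Ch. I §1.2] -/
theorem coe_comp_absGaloisRestrict_of_cyclotomic_zpow {k : ℤ}
    {ε : Field.absoluteGaloisGroup K →ₜ* (PadicAlgCl ℓ)ˣ}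
    (hε : ∀ σ, (ε σ : PadicAlgCl ℓ) =
      (algebraMap ℚ_[ℓ] (PadicAlgCl ℓ) ((GaloisRep.cyclotomicCharacter K ℓ σ : ℤ_[ℓ]ˣ) : ℤ_[ℓ])) ^ k)
    (v : HeightOneSpectrum (𝓞 K)) (σ : Field.absoluteGaloisGroup (v.adicCompletion K)) :
    ((ε.comp (absGaloisRestrict K (v.adicCompletion K)) σ : (PadicAlgCl ℓ)ˣ) : PadicAlgCl ℓ) =
      (algebraMap ℚ_[ℓ] (PadicAlgCl ℓ)
        ((GaloisRep.cyclotomicCharacter (v.adicCompletion K) ℓ σ : ℤ_[ℓ]ˣ) : ℤ_[ℓ])) ^ k := by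
  haveI : NeZero ((ℓ : ℕ) : K) := ⟨Nat.cast_ne_zero.2 (Fact.out : ℓ.Prime).ne_zero⟩
  show ((ε (absGaloisRestrict K (v.adicCompletion K) σ) : (PadicAlgCl ℓ)ˣ) : PadicAlgCl ℓ) = _
  rw [hε, cyclotomicCharacter_absGaloisRestrict]

/-! ### Stub N15-H -/

/-- **Open kernel twisted by a power of the cyclotomic character is de Rham above `ℓ` for THE pinned
datum, in every rank, with no named fact** (the working form, implicit `K, ℓ, n`).  For
`r : Γ_K → GL_n(ℚ̄_ℓ)` with open kernel, `ε = ε_ℓ^k` and `v ∣ ℓ`: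
`(r ⊗ ε)|_{Γ_{K_v}} = r|_{Γ_{K_v}} ⊗ (ε ∘ res_v)` (`toLocal_twist`); `r|_{Γ_{K_v}}` has finite image,
hence is de Rham (`fontainePstAdicCompletion_isDeRhamFramed_of_finite_range`); Tate twists of de Rham
representations are de Rham for THE datum, unconditionally after D1
(`fontainePstAdicCompletion_isDeRhamFramed_tateTwist_of_isDeRhamFramed`); and `ε ∘ res_v = χ_ℓ^k` on
`Γ_{K_v}` (`coe_comp_absGaloisRestrict_of_cyclotomic_zpow`).
[cite: FontaineAsterisque223III, Exp. III §1.5, §3 and Prop. 1.5.2] [cite: SerreAbelianLadic1968, Ch. III §2.3] -/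
theorem isDeRhamFramed_toLocal_twist_of_isOpen_ker {n : ℕ} (r : FramedGaloisRep K (PadicAlgCl ℓ) n)
    (hker : IsOpen (r.toMonoidHom.ker : Set (Field.absoluteGaloisGroup K))) (k : ℤ)
    (ε : Field.absoluteGaloisGroup K →ₜ* (PadicAlgCl ℓ)ˣ)
    (hε : ∀ σ, (ε σ : PadicAlgCl ℓ) =
      (algebraMap ℚ_[ℓ] (PadicAlgCl ℓ) ((GaloisRep.cyclotomicCharacter K ℓ σ : ℤ_[ℓ]ˣ) : ℤ_[ℓ])) ^ k)
    (v : HeightOneSpectrum (𝓞 K)) (hv : ((ℓ : ℕ) : 𝓞 K) ∈ v.asIdeal) :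
    (fontainePstAdicCompletion v ℓ hv).IsDeRhamFramed (FramedGaloisRep.toLocal v (r.twist ε)) := by
  rw [toLocal_twist]
  exact fontainePstAdicCompletion_isDeRhamFramed_tateTwist_of_isDeRhamFramed v hv
    (fontainePstAdicCompletion_isDeRhamFramed_of_finite_range v ℓ hv (r.toLocal v)
      (finite_range_toLocal_of_isOpen_ker_twistDeRham r hker v)) k _
    (coe_comp_absGaloisRestrict_of_cyclotomic_zpow hε v)

/-- **Stub N15-H (closed form registered in the skeleton): `(open kernel) ⊗ ε_ℓ^k` is de Rham above
`ℓ` for THE pinned datum, in every rank, with no named fact.**  For `r : Γ_K → GL_n(ℚ̄_ℓ)` with open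
kernel, `ε = ε_ℓ^k` and `v ∣ ℓ`, Fontaine's pinned datum of `K_v` makes `(r ⊗ ε)|_{Γ_{K_v}}` de Rham:
`r|_{Γ_{K_v}}` has finite image, hence is de Rham
(`fontainePstAdicCompletion_isDeRhamFramed_of_finite_range`), the cyclotomic character is de Rham for
THE datum unconditionally after D1 (`fontainePstAdicCompletion_isDeRhamFramed_cyclotomic`), and Tate
twists of de Rham representations are de Rham (`PstWeilDeligneData.IsDeRhamFramed.tateTwist`,
`toLocal_twist`, `cyclotomicCharacter_absGaloisRestrict`) — all binders explicit, in the order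
`K, ℓ, n, r, hker, k, ε, hε, v, hv` (`isDeRhamFramed_toLocal_twist_of_isOpen_ker`).
[cite: FontaineAsterisque223III, Exp. III §1.5, §3 and Prop. 1.5.2] [cite: SerreAbelianLadic1968, Ch. III §2.3] -/
theorem stub_isDeRhamFramed_twist_of_isOpen_ker :
    ∀ (K : Type) [Field K] [NumberField K] (ℓ : ℕ) [Fact ℓ.Prime] (n : ℕ)
      (r : FramedGaloisRep K (PadicAlgCl ℓ) n),
      IsOpen (r.toMonoidHom.ker : Set (Field.absoluteGaloisGroup K)) →
      ∀ (k : ℤ) (ε : Field.absoluteGaloisGroup K →ₜ* (PadicAlgCl ℓ)ˣ),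
      (∀ σ, (ε σ : PadicAlgCl ℓ) =
        (algebraMap ℚ_[ℓ] (PadicAlgCl ℓ) ((GaloisRep.cyclotomicCharacter K ℓ σ : ℤ_[ℓ]ˣ) : ℤ_[ℓ])) ^ k) →
      ∀ (v : HeightOneSpectrum (𝓞 K)) (hv : ((ℓ : ℕ) : 𝓞 K) ∈ v.asIdeal),
        (Literature.NumberTheory.PAdicHodge.fontainePstAdicCompletion v ℓ hv).IsDeRhamFramed
          (FramedGaloisRep.toLocal v (r.twist ε)) := by
  intro K _ _ ℓ _ n r hker k ε hε v hv
  exact isDeRhamFramed_toLocal_twist_of_isOpen_ker r hker k ε hε v hv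

end Summit.Langlands.Langlands.Theorems.ReciprocityUpToIrreducibility

end
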